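import Summits.QuantumFields.BalabanUV.Beta.EriceRemainderEnclosureHistoryAutonomyComparisonAgeCompositionAgeRatioWindowClusters

/-!
# EriceRemainderEnclosureHistoryAutonomyComparisonAgeCompositionTwoWindowClusters — (E112c) route (N), first order: TWO ARBITRARY DENSE CLUSTERS — A YOUNG
# CLUSTER FAR BELOW AN OLD CLUSTER, every horizon, every damping of the self-consistent class.  (E91c) `flow_nonneg_young_below_cluster` paired ONE young age with
# an arbitrary old cluster; its engine (E91b) `renewal_nonneg_two_reads` only needs a YOUNG READ with rows of mass `≤ s_y` vanishing beyond some lag `i`, an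
# OLD READ with rows `≤ s_o` varying slowly over `d ≤ i` pins (`O_m − O_{m+d} ≤ V·e_m`), and `s_y·V ≤ (1−s_y)(1−s_o)`.  Here the young read is the sum of the
# damped rows of an arbitrary YOUNG CLUSTER `[i₀, I)` (rows `≤ Σ_{j∈[i₀,I)} x_j(m) ≤ s_y`, lags `< I−1`), the old read that of `[k₀, K)` (`Σ x_j ≤ s_o`,
# variation `≤ 4(I−1)·s_o∕k₀·e_m` by (E91a) `old_read_variation` summed over the cluster): **`flow_nonneg_young_cluster_below_cluster`** — IF the two
# cluster loads are `≤ s_y`, `≤ s_o` at every pin (DISPLAYED) and `4·s_y·s_o·(I−1) ≤ (1−s_y)(1−s_o)·k₀` THEN `0 ≤ ε ≤ e`.  With (E112b) `cluster_load_le_log` the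
# displayed loads are DISCHARGED for clusters of bounded span: **`flow_nonneg_two_window_clusters_span_three`** — ANY set of ages inside `[i₀, 3i₀]` and ANY set
# inside `[k₀, 3k₀]` with `k₀ ≥ 133·i₀` (`s_y = s_o = 0.7684`: `4·0.7684²·(3i₀) ≤ 0.2316²·k₀ ⟸ k₀ ≥ 132.1·i₀`) — the first census class with TWO dense blocks of
# arbitrary composition and a young block that may start at age `1` (`{1,2,3} ∪ {140,…,400}`, …).

Cell `pub-balaban`, β-function sub-cell, BINDER row D4 «RemainderConst leaves for Bałaban's split» (`HOME/BINDER-OWNERS.md`; owner lineage `b2b-balaban-beta-an4`;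
this file by co-owner #2 lineage `b2b-balaban-beta-d4-p2`, generation 93), β-FLOW TEAM duty (1), FREEZE (0) honoured (def-free; imports (E112b); uses (E91b)
`renewal_nonneg_two_reads`, (E91a) `old_read_variation`, (E89a) `kernel_entry_le` ∕ `row_mass_le`, (E80b) `aggregate_eq_sum`, (E91c) `cluster_lagZero_le`,
(E112b) `cluster_load_le_log` ∕ `window_const_two` BY NAME; nothing restated).

HONEST FRAMING (page 1, verbatim and binding).  *"Discharging BetaPertH makes Bałaban's UV stability UNCONDITIONAL — a real constructive-QFT result; it is
NOT the continuum limit and NOT the Clay problem."*  THIS FILE DISCHARGES NOTHING OF THE KIND.  Elementary real analysis about ABSTRACT functionals on a box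
]0,γ]^ℕ with displayed floors, profiles and signs, and the FIRST-ORDER renewal objects of route (N) built from them — hypotheses of a census, not facts; the
form, signs, ages and moments of Bałaban's (1.22) limit functional are NOT PRINTED ([I] p. 298; GAPS G-t4-U2-1∕-2) and NOT asserted.  Row D4 class
UNCHANGED (critical-path width 0; instance 0∕1; D4 DISCHARGE NO DATE).  HONEST DEPENDENCY: continuum YM on T⁴ ⇐ BetaPertH ∧ nine spine estimates (0/9
proved); BetaPertH ⇐ (D1) ∧ (D4) ∧ CAP+tail; G-an2-4 gates asym, D1 and NE2/3/4.

THE POINT (README `HOME/b2b-balaban-beta-d4-p2/g93/README.md` §3).  NOT CLAIMED: clusters closer than `×133`; three or more clusters (the cascades (E99c)∕(E110k) take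
block caps of exactly the form (E112b) provides — README §4); anything printed — NOT B12 Thm 2, NOT BetaPertH, NOT continuum, NOT Clay.

WHAT IS PROVED ([folklore]; 0 `def`, 0 sorry).  §1 **`flow_nonneg_young_cluster_below_cluster`** (displayed cluster loads).  §2 **`flow_nonneg_two_window_clusters_span_three`**.
-/
noncomputable section
open Finset

namespace Summit.QuantumFields.BalabanUV.Beta.EriceRemainderEnclosureHistoryAutonomyComparisonAgeCompositionTwoWindowClusters

open Literature.MathematicalPhysics.QuantumFieldTheory.Balaban1983to89
open Literature.MathematicalPhysics.QuantumFieldTheory.Balaban1983to89.T4BetaStationary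
open Literature.MathematicalPhysics.QuantumFieldTheory.Balaban1983to89.T4BetaFlowWellPosed
open Summit.QuantumFields.BalabanUV.Beta.EriceRemainderEnclosureHistoryAutonomyComparisonAgeCompositionYoungestTailSumFlow (kernel_entry_le row_mass_le)
open Summit.QuantumFields.BalabanUV.Beta.EriceRemainderEnclosureHistoryAutonomyComparisonAgeCompositionChainWiring (aggregate_eq_sum)
open Summit.QuantumFields.BalabanUV.Beta.EriceRemainderEnclosureHistoryAutonomyComparisonAgeCompositionTwoAgesOldRead (old_read_variation)
open Summit.QuantumFields.BalabanUV.Beta.EriceRemainderEnclosureHistoryAutonomyComparisonAgeCompositionTwoAgesFar (renewal_nonneg_two_reads)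
open Summit.QuantumFields.BalabanUV.Beta.EriceRemainderEnclosureHistoryAutonomyComparisonAgeCompositionYoungBelowCluster (cluster_lagZero_le)
open Summit.QuantumFields.BalabanUV.Beta.EriceRemainderEnclosureHistoryAutonomyComparisonAgeCompositionAgeRatioWindowClusters (cluster_load_le_log window_const_two)

variable {B : (ℕ → ℝ) → ℝ} {γ b gIR : ℝ} {L : ℕ → ℝ} {K : ℕ} {h g : ℕ → ℝ}

/-! ## §1 A young cluster far below an old cluster, displayed cluster loads -/

/-- **A YOUNG CLUSTER FAR BELOW AN OLD CLUSTER — EVERY HORIZON, EVERY DAMPING OF THE SELF-CONSISTENT CLASS, WHATEVER THE TOTAL LOAD.**  Profile carried by the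
ages in `[i₀, I) ∪ [k₀, K)` with `1 ≤ i₀ < I ≤ k₀ ≤ K` (`L_l = 0` for the other ages `< K`); dampings with `g_t(1 + F_t) ≥ 1`; IF the young cluster's total window
load is `≤ s_y ≤ 1` and the old cluster's `≤ s_o ≤ 1` at every pin, and `4·s_y·s_o·(I−1) ≤ (1−s_y)(1−s_o)·k₀`, THEN `0 ≤ ε ≤ e` at every pin for every admissible
excess ((E91b) `renewal_nonneg_two_reads` with the young read = the young cluster's damped rows (lags `< I−1`), `V = 4(I−1)s_o∕k₀` from (E91a) `old_read_variation`
summed over the old cluster). [folklore] -/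
theorem flow_nonneg_young_cluster_below_cluster (hmono : ∀ u v : ℕ → ℝ, SeqBox γ u → SeqBox γ v → (∀ j, u j ≤ v j) → B u ≤ B v)
    (hL : ∀ k, 0 ≤ L k) (hb : 0 < b) (hlo : ∀ u, SeqBox γ u → b ≤ B u) (hdom : ∀ u, SeqBox γ u → ∑ k ∈ range K, L k * u k ≤ B u)
    (hh : SeqBox γ h) (hf : MemFlow B gIR h) (hg : ∀ t, 0 < g t ∧ g t ≤ 1)
    (hgF : ∀ t, 1 ≤ g t * (1 + ∑ k ∈ range K, L k * h (t + k) ^ 3 / 2))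
    {i₀ I k₀ : ℕ} (hi₀ : 1 ≤ i₀) (hiI : i₀ < I) (hIk : I ≤ k₀) (hk0K : k₀ ≤ K)
    (hLs : ∀ l, l < K → (l < i₀ ∨ (I ≤ l ∧ l < k₀)) → L l = 0)
    {sy so : ℝ} (hsy1 : sy ≤ 1) (hso1 : so ≤ 1)
    (hyoung : ∀ m, ∑ j ∈ Ico i₀ I, (j : ℝ) * (L j * h (m + j) ^ 3 / 2) ≤ sy)
    (hold : ∀ m, ∑ j ∈ Ico k₀ K, (j : ℝ) * (L j * h (m + j) ^ 3 / 2) ≤ so)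
    (hfar : 4 * sy * so * ((I : ℝ) - 1) ≤ (1 - sy) * (1 - so) * k₀)
    {N : ℕ} {KL : ℕ → ℕ → ℕ → ℝ}
    (hKL : ∀ k n l, KL k n l = if 0 < k ∧ k < K ∧ l < k then L k * h (n + k) ^ 3 / 2 * ∏ t ∈ Ico (n + 1 + l) (n + k + 1), g t else 0)
    {KA : ℕ → ℕ → ℕ → ℝ} {RA : ℕ → (ℕ → ℝ) → ℕ → ℝ}
    (hRA : ∀ i v m, RA i v m = ∑ l ∈ range K, KA i m l * v (m + 1 + l))
    (hKA : ∀ i m l, KA i m l = KL i m l + KA (i + 1) m l) (hKAtop : ∀ m l, KA K m l = 0)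
    {e ε : ℕ → ℝ} (he0 : ∀ m, 0 ≤ e m) (hea : ∀ m, e (m + 1) ≤ e m)
    (hεt : ∀ m, N < m → ε m = 0) (hεrec : ∀ m, ε m = e m - RA 1 ε m) : ∀ m, 0 ≤ ε m ∧ ε m ≤ e m := by
  have hpos : ∀ n, 0 < h n := fun n => (hh n).1
  have hk0r : (0 : ℝ) < k₀ := by exact_mod_cast (show 0 < k₀ by omega)
  have hK : 1 ≤ K := by omega
  have hIK : I ≤ K := hIk.trans hk0K
  have hL0 : L 0 = 0 := hLs 0 (by omega) (Or.inl (by omega))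
  -- the young and old loads are non-negative, hence 0 ≤ sy, so
  have hx0 : ∀ j m : ℕ, 0 ≤ (j : ℝ) * (L j * h (m + j) ^ 3 / 2) := fun j m => by have := hL j; have := hpos (m + j); positivity
  have hsy0 : 0 ≤ sy := (sum_nonneg fun j _ => hx0 j 0).trans (hyoung 0)
  have hso0 : 0 ≤ so := (sum_nonneg fun j _ => hx0 j 0).trans (hold 0)
  -- the aggregate row is the young cluster's rows plus the old cluster's rows
  have hKA1 : ∀ m l, KA 1 m l = ∑ j ∈ Ico i₀ I, KL j m l + ∑ j ∈ Ico k₀ K, KL j m l := by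
    intro m l
    have h1 : KA 1 m l = ∑ k' ∈ Ico 1 (K - 1 + 1), KL k' m l :=
      aggregate_eq_sum (n := K - 1) hKA (fun m l => by rw [Nat.sub_add_cancel hK]; exact hKAtop m l) (show 1 ≤ K - 1 + 1 by omega) m l
    have hzero : ∀ j, j < K → (j < i₀ ∨ (I ≤ j ∧ j < k₀)) → KL j m l = 0 := fun j hjK hj => by
      rw [hKL]; split_ifs
      · rw [hLs j hjK hj]; simp
      · rfl
    rw [h1, Nat.sub_add_cancel hK, ← sum_Ico_consecutive _ hi₀ (by omega : i₀ ≤ K), ← sum_Ico_consecutive _ hiI.le hIK,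
      ← sum_Ico_consecutive _ hIk hk0K]
    rw [sum_eq_zero fun j hj => hzero j (by have := (mem_Ico.mp hj).2; omega) (Or.inl (mem_Ico.mp hj).2),
      sum_eq_zero fun j hj => hzero j (by have := (mem_Ico.mp hj).2; omega) (Or.inr ⟨(mem_Ico.mp hj).1, (mem_Ico.mp hj).2⟩)]
    ring
  -- young rows: mass ≤ sy, vanishing from the lag I − 1 on
  have hWy : ∀ m, ∑ l ∈ range K, ∑ j ∈ Ico i₀ I, KL j m l ≤ sy := fun m => by
    rw [sum_comm]
    exact (sum_le_sum fun j hj => row_mass_le hL hh hg hKL (lt_of_lt_of_le (mem_Ico.mp hj).2 hIK) m).trans (hyoung m)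
  have hwyI : ∀ m l, I - 1 ≤ l → ∑ j ∈ Ico i₀ I, KL j m l = 0 := fun m l hl =>
    sum_eq_zero fun j hj => by rw [hKL, if_neg (by have := (mem_Ico.mp hj).2; omega)]
  have hWo : ∀ m, ∑ l ∈ range K, ∑ j ∈ Ico k₀ K, KL j m l ≤ so := fun m => by
    rw [sum_comm]
    exact (sum_le_sum fun j hj => row_mass_le hL hh hg hKL (mem_Ico.mp hj).2 m).trans (hold m)
  have hI1 : (1 : ℝ) ≤ I := by exact_mod_cast (show 1 ≤ I by omega)
  have hV0 : 0 ≤ 4 * ((I : ℝ) - 1) * so / k₀ := by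
    have : 0 ≤ (I : ℝ) - 1 := by linarith
    positivity
  refine renewal_nonneg_two_reads (i := I - 1) (N := N) (Kw := K) (sy := sy) (so := so) (V := 4 * ((I : ℝ) - 1) * so / k₀)
    (wy := fun m l => ∑ j ∈ Ico i₀ I, KL j m l) (wo := fun m l => ∑ j ∈ Ico k₀ K, KL j m l)
    (Y := fun m => ∑ l ∈ range K, (∑ j ∈ Ico i₀ I, KL j m l) * ε (m + 1 + l))
    (O := fun m => ∑ l ∈ range K, (∑ j ∈ Ico k₀ K, KL j m l) * ε (m + 1 + l))
    (fun m l => sum_nonneg fun j _ => (kernel_entry_le hL hh hg hKL j m l).1) hwyI hWy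
    (fun m l => sum_nonneg fun j _ => (kernel_entry_le hL hh hg hKL j m l).1) hWo
    hsy1 hso1 hV0 ?_ (fun _ => rfl) (fun _ => rfl) he0 hea ?_ hεt ?_
  · -- the condition sy·(4(I−1)so∕k₀) ≤ (1−sy)(1−so)
    rw [show sy * (4 * ((I : ℝ) - 1) * so / k₀) = (4 * sy * so * ((I : ℝ) - 1)) / k₀ by ring, div_le_iff₀ hk0r]
    linarith
  · -- the old cluster's read varies slowly over d ≤ I − 1 pins: sum (E91a) over the cluster
    intro m d hd1 hdi IH
    have hem := he0 m
    have e1 : ∀ p, ∑ l ∈ range K, (∑ j ∈ Ico k₀ K, KL j p l) * ε (p + 1 + l)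
        = ∑ j ∈ Ico k₀ K, ∑ l ∈ range K, KL j p l * ε (p + 1 + l) := fun p => by
      simp only [sum_mul]; rw [sum_comm]
    show ∑ l ∈ range K, (∑ j ∈ Ico k₀ K, KL j m l) * ε (m + 1 + l)
        - ∑ l ∈ range K, (∑ j ∈ Ico k₀ K, KL j (m + d) l) * ε (m + d + 1 + l) ≤ 4 * ((I : ℝ) - 1) * so / k₀ * e m
    rw [e1 m, e1 (m + d), ← sum_sub_distrib]
    have hstep : ∀ j ∈ Ico k₀ K, ∑ l ∈ range K, KL j m l * ε (m + 1 + l) - ∑ l ∈ range K, KL j (m + d) l * ε (m + d + 1 + l)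
        ≤ 4 * d * (L j * h (m + j) ^ 3 / 2) * e m := fun j hj =>
      old_read_variation hmono hL hb hlo hdom hh hf hL0 hg hgF hKL (by have := (mem_Ico.mp hj).1; omega) (mem_Ico.mp hj).2 hd1
        (by have := (mem_Ico.mp hj).1; omega) he0 hea IH
    refine (sum_le_sum hstep).trans ?_
    rw [← sum_mul, ← mul_sum]
    have hc := cluster_lagZero_le (K := K) hL hh (show 1 ≤ k₀ by omega) m
    have hsum0 : 0 ≤ ∑ j ∈ Ico k₀ K, L j * h (m + j) ^ 3 / 2 :=
      sum_nonneg fun j _ => by have := hL j; have := hpos (m + j); positivity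
    have hdr : (d : ℝ) ≤ (I : ℝ) - 1 := by
      have : ((d : ℕ) : ℝ) ≤ ((I - 1 : ℕ) : ℝ) := by exact_mod_cast hdi
      rwa [Nat.cast_sub (by omega), Nat.cast_one] at this
    have hd0 : (0 : ℝ) ≤ d := Nat.cast_nonneg d
    calc 4 * (d : ℝ) * (∑ j ∈ Ico k₀ K, L j * h (m + j) ^ 3 / 2) * e m
        ≤ 4 * ((I : ℝ) - 1) * ((1 / (k₀ : ℝ)) * so) * e m := by
          refine mul_le_mul_of_nonneg_right ?_ hem
          have h1 : ∑ j ∈ Ico k₀ K, L j * h (m + j) ^ 3 / 2 ≤ (1 / (k₀ : ℝ)) * so :=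
            hc.trans (mul_le_mul_of_nonneg_left (hold m) (by positivity))
          nlinarith [mul_le_mul hdr h1 hsum0 (by linarith)]
      _ = 4 * ((I : ℝ) - 1) * so / k₀ * e m := by field_simp
  · intro m
    rw [hεrec m, hRA]
    have : ∑ l ∈ range K, KA 1 m l * ε (m + 1 + l)
        = ∑ l ∈ range K, (∑ j ∈ Ico i₀ I, KL j m l) * ε (m + 1 + l) + ∑ l ∈ range K, (∑ j ∈ Ico k₀ K, KL j m l) * ε (m + 1 + l) := by
      rw [← sum_add_distrib]; exact sum_congr rfl fun l _ => by rw [hKA1]; ring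
    rw [this]; ring

/-! ## §2 Both clusters of span three: the loads discharged by the logarithmic window bound -/

/-- **TWO ARBITRARY CLUSTERS OF SPAN THREE.**  Profile carried by ANY set of ages inside `[i₀, 3i₀]` and ANY set inside `[k₀, 3k₀]`, `i₀ ≥ 1`, `k₀ ≥ 133·i₀`
(so `3i₀ < k₀`), `K ≤ 3k₀ + 1`, `L_l = 0` for the other ages `< K`; isotone dominating memory with floor, box solution, damping of the self-consistent class.
THEN `0 ≤ ε ≤ e` for every admissible excess and every horizon — §1 with `s_y = s_o = 0.7684` ((E112b) `cluster_load_le_log` + `window_const_two` for both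
clusters) and `4·0.7684²·(3i₀) ≤ 0.2316²·133·i₀`. [folklore] -/
theorem flow_nonneg_two_window_clusters_span_three (hmono : ∀ u v : ℕ → ℝ, SeqBox γ u → SeqBox γ v → (∀ j, u j ≤ v j) → B u ≤ B v)
    (hL : ∀ k, 0 ≤ L k) (hb : 0 < b) (hlo : ∀ u, SeqBox γ u → b ≤ B u) (hdom : ∀ u, SeqBox γ u → ∑ k ∈ range K, L k * u k ≤ B u)
    (hh : SeqBox γ h) (hf : MemFlow B gIR h) (hg : ∀ t, 0 < g t ∧ g t ≤ 1)
    (hgF : ∀ t, 1 ≤ g t * (1 + ∑ k ∈ range K, L k * h (t + k) ^ 3 / 2))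
    {i₀ k₀ : ℕ} (hi₀ : 1 ≤ i₀) (hfar : 133 * i₀ ≤ k₀) (hk0K : k₀ ≤ K) (hK3 : K ≤ 3 * k₀ + 1)
    (hLs : ∀ l, l < K → (l < i₀ ∨ (3 * i₀ + 1 ≤ l ∧ l < k₀)) → L l = 0)
    {N : ℕ} {KL : ℕ → ℕ → ℕ → ℝ}
    (hKL : ∀ k n l, KL k n l = if 0 < k ∧ k < K ∧ l < k then L k * h (n + k) ^ 3 / 2 * ∏ t ∈ Ico (n + 1 + l) (n + k + 1), g t else 0)
    {KA : ℕ → ℕ → ℕ → ℝ} {RA : ℕ → (ℕ → ℝ) → ℕ → ℝ}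
    (hRA : ∀ i v m, RA i v m = ∑ l ∈ range K, KA i m l * v (m + 1 + l))
    (hKA : ∀ i m l, KA i m l = KL i m l + KA (i + 1) m l) (hKAtop : ∀ m l, KA K m l = 0)
    {e ε : ℕ → ℝ} (he0 : ∀ m, 0 ≤ e m) (hea : ∀ m, e (m + 1) ≤ e m)
    (hεt : ∀ m, N < m → ε m = 0) (hεrec : ∀ m, ε m = e m - RA 1 ε m) : ∀ m, 0 ≤ ε m ∧ ε m ≤ e m := by
  have hi0r : (1 : ℝ) ≤ i₀ := by exact_mod_cast hi₀
  have hfarr : (133 : ℝ) * i₀ ≤ k₀ := by exact_mod_cast hfar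
  have hk0r : (0 : ℝ) < k₀ := by linarith
  have hKr : ((K : ℕ) : ℝ) ≤ ((3 * k₀ + 1 : ℕ) : ℝ) := by exact_mod_cast hK3
  have hKk : ((k₀ : ℕ) : ℝ) ≤ ((K : ℕ) : ℝ) := by exact_mod_cast hk0K
  push_cast at hKr hKk
  -- the young cluster [i₀, 3i₀+1): load ≤ 0.7684 at every pin
  have hI : i₀ + 1 ≤ 3 * i₀ + 1 := by omega
  have hIK : 3 * i₀ + 1 ≤ K := by omega
  have hy : ∀ m, ∑ j ∈ Ico i₀ (3 * i₀ + 1), (j : ℝ) * (L j * h (m + j) ^ 3 / 2) ≤ 0.7684 := by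
    intro m
    have h1 := cluster_load_le_log hmono hL hb hlo hdom hh hf hi₀ hI hIK m
    have hx0 : (0 : ℝ) < ((i₀ : ℝ) + ((3 * i₀ + 1 : ℕ) : ℝ) - 1) / (2 * (i₀ : ℝ)) := by push_cast; apply div_pos <;> linarith
    have hx2 : ((i₀ : ℝ) + ((3 * i₀ + 1 : ℕ) : ℝ) - 1) / (2 * (i₀ : ℝ)) ≤ 2 := by push_cast; rw [div_le_iff₀ (by positivity)]; linarith
    have hw := window_const_two hx0 hx2
    rw [Real.log_div (by push_cast; linarith) (by positivity)] at hw
    exact h1.trans hw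
  -- the old cluster [k₀, K): load ≤ 0.7684 at every pin (empty if K = k₀)
  have ho : ∀ m, ∑ j ∈ Ico k₀ K, (j : ℝ) * (L j * h (m + j) ^ 3 / 2) ≤ 0.7684 := by
    intro m
    rcases Nat.lt_or_ge k₀ K with hlt | hge
    · have h1 := cluster_load_le_log hmono hL hb hlo hdom hh hf (show 1 ≤ k₀ by omega) (by omega) le_rfl m
      have hx0 : (0 : ℝ) < ((k₀ : ℝ) + K - 1) / (2 * (k₀ : ℝ)) := by apply div_pos <;> linarith
      have hx2 : ((k₀ : ℝ) + K - 1) / (2 * (k₀ : ℝ)) ≤ 2 := by rw [div_le_iff₀ (by positivity)]; linarith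
      have hw := window_const_two hx0 hx2
      rw [Real.log_div (by linarith) (by positivity)] at hw
      exact h1.trans hw
    · rw [Ico_eq_empty_of_le hge, sum_empty]; norm_num
  refine flow_nonneg_young_cluster_below_cluster hmono hL hb hlo hdom hh hf hg hgF hi₀ (show i₀ < 3 * i₀ + 1 by omega) (by omega) hk0K
    hLs (sy := 0.7684) (so := 0.7684) (by norm_num) (by norm_num) hy ho ?_ hKL hRA hKA hKAtop he0 hea hεt hεrec
  push_cast
  nlinarith

end Summit.QuantumFields.BalabanUV.Beta.EriceRemainderEnclosureHistoryAutonomyComparisonAgeCompositionTwoWindowClusters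

end
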